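import Summits.BirchSwinnertonDyer.Uniform.U2.ZhaiUnitOfBase
import Summits.BirchSwinnertonDyer.Uniform.U2.TwistTamagawaTwoAdicMult
import Summits.BirchSwinnertonDyer.Uniform.U2.TransportAOddTrace
import Summits.BirchSwinnertonDyer.Uniform.U2.TransportARankZeroBoxerDiao
import Literature.NumberTheory.EllipticCurves.AnalyticRankModularityProofs
import HarnessLib

/-!
# Track U2 (cell `bsd-uniform`, seat u2-p1): `BSD(E, 2) ⟹ BSD(E^{(d)}, 2)` UNIFORMLY on the
# `a_q`-odd class — RANK-ZERO OPTIMAL bases, NO per-twist binder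

HONEST FRAMING (cell `bsd-uniform`, HOME run/shared/lean/pub/bsd-uniform/, verbatim in every file of
the seat): a RELATIVE ("twist-transport") theorem, uniform in the twisting parameter `d`, CONDITIONAL
on FOUR NAMED PUBLISHED FACTS taken BY NAME — Zhai 2016 Thm 1.1 / 1.2 AS CORRECTED (`h11` / `h12`:
`Zhai2016.thm11_ordTwo_LAlg_twist_eq_zero'` / `thm12_ordTwo_LAlg_twist_eq_one'`, arXiv v2: odd Manin
constant), Mazur–Rubin 2010 Cor. 3.4 (ii) (`hMR`), modularity (`hmod`) — and on PER-BASE binders of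
the rank-`0` base `E` ONLY: a globally minimal `Γ₀(N)`-OPTIMAL model with ODD MANIN CONSTANT
(`Dt`/`hopt`/`hν`), `r_an(E) = 0`, `BSD(E, 2)`, `Ш(E)[2] = 0`, (H-2) `E(ℚ)[2] = 0`, `c(E)` odd; and the
ARITHMETIC class condition on `(E, d)`: `d ≡ 1 (mod 8)` square-free, `≠ 1`, prime to `N`, every
`q ∣ d` good with `a_q(E)` odd, Mazur–Rubin's splitting (`hadd`/`hmev`: odd additive and even-`ord`
multiplicative primes split in `ℚ(√d)`), `d > 0` if `Δ > 0`. THERE IS NO PER-TWIST BINDER. It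
converts PAIRS `(E, d)` to `BSD(E^{(d)}, 2)`, never the class X5 by itself; it books nothing; it moves
no census number; no per-curve certificate is counted as a uniform theorem — the base's `BSD(E, 2)`
is a per-BASE CERTIFICATE and the twists of a certified rank-`0` base are CERTIFICATE-DERIVED («transport
theorem × base certificate»), with NO per-twist certificate; only the twists of a base whose `BSD₂` is
itself LITERAL (CM / Kriz–Li families) are literal (referee V2 CORRECTION 1; wording of record V97 F97-1,
ERRATUM 2026-08-27: an earlier version of this docstring said «the twists are then LITERAL»).

THE THEOREM (`bsdp_two_twist_of_rankZero_base`). Under the binders above, for every globally minimal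
model `WM` of `E^{(d)}`: `r_an(E^{(d)}) = 0`, `rank E^{(d)}(ℚ) = 0`, `Ш(E^{(d)})[2^∞] = 0`,
`∏ c_ℓ(E^{(d)})` odd, and **`BSD(E^{(d)}, 2)`** (Miller). Assembly of the seat's kernel theorems:
* ANALYTIC side — `ZhaiUnitOfBase.rankZero_twist_of_zhai'` (p518943): Zhai 1.1′ / 1.2′ with the cubic
  field and «`q` inert» DISCHARGED from `a_q` odd (`CubicFieldInertOddTrace`, p517725) give
  `L(E^{(d)}, 1) = q · Ω(E^{(d)})`, `q ≠ 0`, `ord₂ q = 0`, `r_an = 0`, rank `0`, `Reg = 1`, `Ш` finite;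
* ALGEBRAIC side — route A `TransportAOddTrace.routeA_oddTrace_rank_zero` (Mazur–Rubin control on the
  `a_q`-odd class): `E^{(d)}(ℚ)[2] = 0`, `Ш(E^{(d)})[2^∞] = 0`;
* LOCAL side — `TwistTamagawaTwoAdicMult.padicValNat_two_tamagawaProduct_twist_eq_of_mazurRubin`
  (p522556): `ord₂ ∏ c(E^{(d)}) = ord₂ ∏ c(E) = 0`;
* bookkeeping — `#Ш_an(E^{(d)}) = q · T² / c` has `ord₂ = 0 = ord₂ #Ш(E^{(d)})[2^∞]`.
Relation to print: for Boxer–Diao «good» bases this is Zhai's remark after Thm 1.1 (tree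
`bsdp_two_twist_of_zhai11'_boxerDiao`); arXiv v2 of Zhai 2016 states the `2`-part of BSD for the twists
when the bad primes SPLIT in `ℚ(√M)` and BSD₂(E) holds (its Thms 1.2 / 1.4, not vendored); here the
odd-`ord` multiplicative primes may also be INERT, `Ш` is controlled by Mazur–Rubin, and every input is
either a NAMED fact or a PER-BASE invariant.

## Contents (theorems only; no `def`, no named fact)
* **`bsdp_two_twist_of_rankZero_base`**.

References: Zhai 2016 [Zhai2016]; Mazur–Rubin 2010 [MazurRubin2010]; Boxer–Diao 2010 (the printed
special case) [BoxerDiao2010]; Silverman *ATAEC* IV.9 [SilvermanATAEC1994]; Miller 2011 Def. 1.1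
[Miller2011LMS].
-/

noncomputable section

open scoped Classical AddSubgroup

open NumberField WeierstrassCurve Literature.NumberTheory.EllipticCurves
  Literature.NumberTheory.EllipticCurves.ModularForms
  Literature.NumberTheory.EllipticCurves.Rank1Residual
  Literature.NumberTheory.EllipticCurves.Zhai2016
  Summit.BirchSwinnertonDyer.Rank1Residual

namespace Summit.BirchSwinnertonDyer.Uniform.U2

/-- **`BSD(E, 2) ⟹ BSD(E^{(d)}, 2)` on the `a_q`-odd class, rank-`0` optimal bases — NO per-twist
binder.** `E / ℚ` with globally minimal `Γ₀(N)`-optimal model `W` of odd Manin constant (`Dt`, `hopt`,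
`hν`), `r_an(E) = 0`, `BSD(E, 2)`, `Ш(E)[2] = 0`, `E(ℚ)[2] = 0`, `c(E)` odd; `d ≡ 1 (mod 8)` square-free,
`d ≠ 1`, `(d, N) = 1`, every prime `q ∣ d` good with `a_q` odd (`hS`), Mazur–Rubin splitting
`hadd`/`hmev`, `d > 0` if `Δ_E > 0`; `WM` a globally minimal model of `E^{(d)}`. Then, granting Zhai
2016 Thm 1.1′ / 1.2′, Mazur–Rubin Cor. 3.4 (ii) and modularity BY NAME: `r_an(E^{(d)}) = 0`,
`rank E^{(d)}(ℚ) = 0`, `Ш(E^{(d)})[2^∞] = 0`, `∏ c_ℓ(E^{(d)})` odd, and `BSD(E^{(d)}, 2)`.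
[cite: Zhai2016, Thm. 1.1 and Thm. 1.2 with the remark after Thm. 1.1 (arXiv:1409.0231v2 Thm. 1.1 / 1.3)]
[cite: MazurRubin2010, Cor. 3.4 (ii) with Prop. 3.3 and Prop. 4.2]
[cite: SilvermanATAEC1994, Cor. IV.9.2(d) and IV.9.4 Step 2] [cite: Miller2011LMS, Def. 1.1] -/
theorem bsdp_two_twist_of_rankZero_base
    -- named published facts
    (h11 : thm11_ordTwo_LAlg_twist_eq_zero') (h12 : thm12_ordTwo_LAlg_twist_eq_one')
    (hMR : MazurRubin2010.cor34ii_rat) (hmod : exists_isNewformOf)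
    -- the base `E` (rank `0`, optimal, odd Manin constant) and a globally minimal model of `E^{(d)}`
    (W WM : WeierstrassCurve ℚ) [W.IsElliptic] [W.IsGloballyMinimal] [NeZero (W.conductorNorm ℤ)]
    [WM.IsElliptic] [WM.IsGloballyMinimal]
    (Dt : ModularParametrizationData W (W.conductorNorm ℤ)) (hopt : Zhai2021.IsOptimalDatum W Dt)
    (hν : ¬ (2 : ℤ) ∣ Dt.c)
    -- PER BASE
    (hr : W.analyticRank = 0) (hbsd : BSDp W 2)
    (hSha : ∀ x : W.galH1, x ∈ W.sha → 2 • x = 0 → x = 0)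
    (hT : ∀ P : W.toAffine.Point, 2 • P = 0 → P = 0) (hc : Odd W.tamagawaProduct)
    -- the class condition on `(E, d)`
    {d : ℤ} (hsqf : Squarefree d) (hd1 : d ≠ 1) (hd8 : d % 8 = 1)
    (hgcd : Int.gcd d (W.conductorNorm ℤ) = 1)
    (hS : ∀ (q : ℕ), q.Prime → (q : ℤ) ∣ d →
      ¬ (q : ℤ) ∣ minimalDiscriminantInt W ∧ Odd (W.frobeniusTrace q))
    (hadd : ∀ (p : ℕ) [Fact p.Prime], ¬ W.HasGoodReductionAtPrime p →
      ¬ W.HasMultiplicativeReductionAtPrime p → p ≠ 2 → jacobiSym d p = 1)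
    (hmev : ∀ (p : ℕ) [Fact p.Prime], W.HasMultiplicativeReductionAtPrime p →
      Even (padicValRat p W.Δ) → p ≠ 2 → jacobiSym d p = 1)
    (hreal : 0 < W.Δ → 0 < d)
    (hM : ∃ C : VariableChange ℚ, C • WM = W.quadraticTwist (d : ℚ)) :
    WM.analyticRank = 0 ∧ WM.mordellWeilRank = 0 ∧ AddCommGroup.primaryComponent WM.sha 2 = ⊥ ∧
      Odd WM.tamagawaProduct ∧ BSDp WM 2 := by
  haveI : Fact (Nat.Prime 2) := ⟨Nat.prime_two⟩
  have hd4 : d % 4 = 1 := by omega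
  -- ANALYTIC side: Zhai 1.1' / 1.2'
  obtain ⟨hr', hrk, hReg, ⟨q, hq, hq0, hvq⟩, hfin⟩ := rankZero_twist_of_zhai' h11 h12
    (WeierstrassCurve.hasEntireLFunction_rat_of_exists_isNewformOf hmod) W WM Dt hopt hν hr hbsd hSha
    hT hc hsqf hd4 hd1 hgcd hS hreal hM
  -- ALGEBRAIC side: route A (Mazur–Rubin control, rank-zero base)
  have hW2 : W.toAffine.Point[(2 : ℤ)] = ⊥ := torsionBy_two_eq_bot_iff.mpr hT
  have hWsha : (W.sha)[(2 : ℤ)] = ⊥ := torsionBy_two_eq_bot_iff.mpr fun x hx =>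
    Subtype.ext (hSha x x.2 (by exact_mod_cast congrArg Subtype.val hx))
  have hWr : W.mordellWeilRank = 0 := hbsd.1.trans hr
  obtain ⟨-, hM2, hshaM⟩ :=
    routeA_oddTrace_rank_zero W hMR hsqf hd1 hd8 hS hadd hmev hreal hW2 hWsha hWr WM hM
  -- LOCAL side: `ord₂ ∏ c(E^{(d)}) = ord₂ ∏ c(E) = 0`
  have hcv := padicValNat_two_tamagawaProduct_twist_eq_of_mazurRubin W hd8 hS hadd hmev hM
  have hc0 : padicValNat 2 W.tamagawaProduct = 0 :=
    padicValNat.eq_zero_of_not_dvd (Nat.two_dvd_ne_zero.mpr (Nat.odd_iff.mp hc))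
  have hcM0 : padicValNat 2 WM.tamagawaProduct = 0 := hcv.trans hc0
  have hcM : Odd WM.tamagawaProduct := by
    have h := hcM0
    rw [padicValNat.eq_zero_iff] at h
    rcases h with h | h | h
    · norm_num at h
    · exact absurd h WM.tamagawaProduct_pos_holds.ne'
    · exact Nat.odd_iff.mpr (Nat.two_dvd_ne_zero.mp h)
  -- odd torsion of the twist
  have h1M : Nat.card {P : WM.toAffine.Point // (2 : ℕ) • P = 0} = 1 :=
    natCard_twoTorsionSubtype_eq_one_of_torsionBy_eq_bot hM2
  have htorM : padicValNat 2 WM.torsionOrder = 0 :=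
    padicValNat_torsionOrder_eq_zero_of_irreducible WM 2 (P2.irr_two_of_card_twoTorsion_eq_one WM h1M)
  -- bookkeeping: `#Ш_an(E^{(d)}) = q T² / c`, of `2`-adic valuation `0 = ord₂ #Ш[2^∞]`
  have hTpos : (0 : ℕ) < WM.torsionOrder := WM.torsionOrder_pos_holds
  have hcpos : 0 < WM.tamagawaProduct := WM.tamagawaProduct_pos'
  have hΩ : (WM.realPeriodRat : ℂ) ≠ 0 := by exact_mod_cast WM.realPeriodRat_pos_holds.ne'
  have hTq : (WM.torsionOrder : ℚ) ≠ 0 := by exact_mod_cast hTpos.ne'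
  have hcq : (WM.tamagawaProduct : ℚ) ≠ 0 := by exact_mod_cast hcpos.ne'
  refine ⟨hr', hrk, hshaM, hcM, hrk.trans hr'.symm, finite_primaryComponent_sha_of_finite WM hfin,
    q * (WM.torsionOrder : ℚ) ^ 2 / (WM.tamagawaProduct : ℚ), ?_, ?_⟩
  · rw [shaAn_def, hq, hReg]
    push_cast
    field_simp
  · rw [hshaM, AddSubgroup.card_bot, padicValNat_one_right,
      padicValRat.div (mul_ne_zero hq0 (pow_ne_zero 2 hTq)) hcq,
      padicValRat.mul hq0 (pow_ne_zero 2 hTq), padicValRat.pow, padicValRat.of_nat,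
      padicValRat.of_nat, hvq, htorM, hcM0]
    simp

end Summit.BirchSwinnertonDyer.Uniform.U2

end
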